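/-
Copyright (c) 2026 the pub-hodgecm-mathlib formalisation cell (harness21).  Prover seat hodgecm-mathlib-K2E3-p20 (g3), Track B «K2-LIT» ∕ h413,
line `K2_E3_EllipticInputs`, unit U12 «Characters», socket #11, road (11-SC), letter (SC-an), brick (D4) «the majorant is `L¹_loc`», ELEMENTARY HALF:
`|D|^{−1∕2}(1+|λ|)^{4ℓ} ∈ L¹_loc` ⟸ `|D|^{−1∕2−ε} ∈ L¹_loc` (Harish-Chandra 1970 Thm 15 + p. 73).  Deal K2E3-plan (g2) 2026-09-04T01:04:01Z «then (D4)'s elementary comparison».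
2026-09-04.
-/
import Mathlib.Analysis.SpecialFunctions.Pow.Real
import Mathlib.Analysis.SpecialFunctions.Pow.Continuity
import Mathlib.Analysis.SpecialFunctions.Log.Basic
import Mathlib.MeasureTheory.Function.LocallyIntegrable
import Mathlib.Topology.Instances.NNReal.Lemmas
import Literature.NumberTheory.LFunctions.XiMomentConcentration   -- ★ `Literature.NumberTheory.LFunctions.add_pow_le_two_pow` ((a+b)^k ≤ 2^k(a^k+b^k)), reused (dedup)
import HarnessLib

/-!
# K2_E3 road (h413 = stmt-HodgeConjecture-24833), unit U12, socket #11, road (11-SC), letter (SC-an) — brick (D4), ELEMENTARY HALF: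
# a log-weighted inverse `φ⁻¹ (1 + |log φ|)^k` is locally integrable as soon as `φ^{−(1+δ)}` is (HC's «`|D|^{−1∕2}(1+|λ|)^{4ℓ}` is locally summable» from Thm 15)

Cell `pub/hodgecm-mathlib` (D-0151), Track B; letter **(SC-an)** `sig_K2E3SupercuspidalTruncatedCharAnalytic`; ★ p856355 `K2E3SupercuspidalTruncatedCharDominationOfBricks`
consumes (D4′) `hW : LocallyIntegrable W μ` for the weight `W = c·|D_G|^{−1∕2}(1+|λ|)^{4ℓ}`, `q^{λ(x)} = |D(x)|`, of [HarishChandra1970, Part VII §3 p. 73].  Harish-Chandra: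
«It follows from Theorem 15 that the function `x ↦ |D(x)|^{−1∕2}(1+|λ(x)|)^{4ℓ}` is locally summable on `G`» — Theorem 15 being `|D|^{−1∕2−ε} ∈ L¹_loc` for SOME `ε > 0`, and the
passage the ELEMENTARY inequality `(1 + |log t|)^k ≤ C_{k,δ}(t^δ + t^{−δ})` (`t > 0`).  THIS FILE is that passage, GENERIC (Mathlib only): for a CONTINUOUS `φ : X → ℝ≥0` on a
topological measurable space with a locally finite measure — at `U_N(H)(L⁺_v)`: `φ = |D_G|_v^{1∕2}`, the continuous ★ `dgFormula` of the HC-D road, with `|D|^{−1∕2} = φ⁻¹`,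
`(1+|λ|) ≍ (1 + |log φ|)` and Theorem 15's `|D|^{−1∕2−ε} = (φ^{1+2ε})⁻¹` (★ `…cuspDiscriminant_rpow_neg_lt_top` covers every exponent `s` with `6s < 5`) —
`LocallyIntegrable (φ^{1+δ})⁻¹ ⇒ LocallyIntegrable (φ⁻¹ · (1 + |log φ|)^k)`.  `--supports stmt-HodgeConjecture-24833 --as helper`; THEOREMS ONLY — no `def`, no named fact,
no instance, no notation, no `sorry`.  Deal: K2E3-plan (g2) 01:04:01Z (D4)'s elementary comparison.

* §1 real inequalities: `two_le_rpow_add_rpow_neg` (`t^δ + t^{−δ} ≥ 2`), `abs_log_le_rpow_add_rpow_neg_div` (`|log t| ≤ (t^δ + t^{−δ})∕δ`), ★ `add_pow_le_two_pow`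
  (`(a+b)^k ≤ 2^k(a^k + b^k)`, reused from `Literature/NumberTheory/LFunctions`), **`exists_const_one_add_abs_log_pow_le`** (`(1+|log t|)^k ≤ C(t^δ + t^{−δ})`), `rpow_sub_one_le` (`t^{δ−1} ≤ (t^{1+δ})⁻¹ + 1`, `0 < δ ≤ 1`… any `δ > 0`).
* §2 **`locallyIntegrable_inv_mul_log_pow`** (the (D4) passage) and its `ℝ`-valued-with-constant form `locallyIntegrable_const_mul_inv_mul_log_pow`.

HONEST LABEL: HC_CM is proved only modulo the 7 printed citations (2 remaining named inputs: hLiu418 = stmt-HodgeConjecture-24832, h413 =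
stmt-HodgeConjecture-24833) until rung 0 closes; count-neutral `--supports` helper (elementary real analysis; Theorem 15 itself — the `|D|^{−1∕2−ε}` input — is NOT proved here).

## References
* [HarishChandra1970] Harish-Chandra (notes by G. van Dijk), *Harmonic Analysis on Reductive p-adic Groups*, LNM 162 (1970), Part VII §1 Thm 15 p. 63; §3 p. 73.
-/

set_option autoImplicit false
-- the mandated namespace has the single-problem summit's repeated segment (`HodgeConjecture.HodgeConjecture`)
set_option linter.dupNamespace false

noncomputable section

open MeasureTheory Topology Filter Real
open scoped NNReal

namespace Summit.HodgeConjecture.HodgeConjecture.Cruxes.H413.K2E3LogWeightLocallyIntegrable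

/-! ## §1 Real inequalities: `(1 + |log t|)^k ≤ C (t^δ + t^{−δ})` -/

/-- `t^δ + t^{−δ} ≥ 2` for `t > 0` (AM–GM: `a + a⁻¹ ≥ 2`). [cite: HarishChandra1970, Part VII §3 p. 73] -/
theorem two_le_rpow_add_rpow_neg {t : ℝ} (ht : 0 < t) (δ : ℝ) : 2 ≤ t ^ δ + t ^ (-δ) := by
  have ha : 0 < t ^ δ := rpow_pos_of_pos ht δ
  rw [rpow_neg ht.le]
  have h : t ^ δ + (t ^ δ)⁻¹ - 2 = (t ^ δ - 1) ^ 2 / t ^ δ := by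
    field_simp
    ring
  have h2 : 0 ≤ (t ^ δ - 1) ^ 2 / t ^ δ := div_nonneg (sq_nonneg _) ha.le
  linarith

/-- `|log t| ≤ (t^δ + t^{−δ}) ∕ δ` for `t > 0`, `δ > 0` (`log t ≤ t^δ∕δ` and `−log t = log t⁻¹ ≤ t^{−δ}∕δ`, Mathlib `Real.log_le_rpow_div`).
[cite: HarishChandra1970, Part VII §3 p. 73] -/
theorem abs_log_le_rpow_add_rpow_neg_div {t δ : ℝ} (ht : 0 < t) (hδ : 0 < δ) : |log t| ≤ (t ^ δ + t ^ (-δ)) / δ := by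
  have h1 : log t ≤ t ^ δ / δ := log_le_rpow_div ht.le hδ
  have h2 : -log t ≤ t ^ (-δ) / δ := by
    rw [← log_inv, rpow_neg ht.le, ← inv_rpow ht.le]
    exact log_le_rpow_div (inv_nonneg.2 ht.le) hδ
  have hp : 0 ≤ t ^ δ / δ := div_nonneg (rpow_nonneg ht.le δ) hδ.le
  have hn : 0 ≤ t ^ (-δ) / δ := div_nonneg (rpow_nonneg ht.le _) hδ.le
  rw [add_div]
  rcases le_or_gt 0 (log t) with h | h
  · rw [abs_of_nonneg h]; linarith
  · rw [abs_of_neg h]; linarith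

/-- **`(1 + |log t|)^k ≤ C · (t^δ + t^{−δ})` for all `t > 0`**, with `C = C(k, δ) > 0` (`δ > 0`) — the elementary estimate behind «`|D|^{−1∕2}(1+|λ|)^{4ℓ}` is locally
summable» given Theorem 15.  (Apply the two lemmas above with `δ∕k`: `1 + |log t| ≤ (½ + k∕δ)(t^{δ∕k} + t^{−δ∕k})`, then `(·)^k` and `(t^{δ∕k})^k = t^δ`.)
[cite: HarishChandra1970, Part VII §3 p. 73] -/
theorem exists_const_one_add_abs_log_pow_le (k : ℕ) {δ : ℝ} (hδ : 0 < δ) :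
    ∃ C : ℝ, 0 < C ∧ ∀ t : ℝ, 0 < t → (1 + |log t|) ^ k ≤ C * (t ^ δ + t ^ (-δ)) := by
  rcases Nat.eq_zero_or_pos k with hk | hk
  · -- `k = 0`: `1 ≤ ½ (t^δ + t^{−δ})`
    refine ⟨1 / 2, by norm_num, fun t ht => ?_⟩
    rw [hk, pow_zero]
    have := two_le_rpow_add_rpow_neg ht δ
    linarith
  · set δ' : ℝ := δ / k with hδ'
    have hk0 : (0 : ℝ) < k := by exact_mod_cast hk
    have hδ'pos : 0 < δ' := div_pos hδ hk0
    set c₁ : ℝ := 1 / 2 + 1 / δ' with hc₁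
    have hc₁pos : 0 < c₁ := by rw [hc₁]; positivity
    refine ⟨c₁ ^ k * 2 ^ k, by positivity, fun t ht => ?_⟩
    have hS2 := two_le_rpow_add_rpow_neg ht δ'
    have hlog := abs_log_le_rpow_add_rpow_neg_div ht hδ'pos
    have ha : 0 ≤ t ^ δ' := rpow_nonneg ht.le _
    have hb : 0 ≤ t ^ (-δ') := rpow_nonneg ht.le _
    -- `1 + |log t| ≤ c₁ (t^δ' + t^{−δ'})`
    have h1 : 1 + |log t| ≤ c₁ * (t ^ δ' + t ^ (-δ')) := by
      rw [hc₁, add_mul, one_div, one_div, inv_mul_eq_div, inv_mul_eq_div]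
      have : (1 : ℝ) ≤ (t ^ δ' + t ^ (-δ')) / 2 := by linarith
      linarith
    have h0 : 0 ≤ 1 + |log t| := by positivity
    -- raise to the `k`-th power
    have h2 : (1 + |log t|) ^ k ≤ c₁ ^ k * (2 ^ k * ((t ^ δ') ^ k + (t ^ (-δ')) ^ k)) := by
      calc (1 + |log t|) ^ k ≤ (c₁ * (t ^ δ' + t ^ (-δ'))) ^ k := pow_le_pow_left₀ h0 h1 k
        _ = c₁ ^ k * (t ^ δ' + t ^ (-δ')) ^ k := by rw [mul_pow]
        _ ≤ c₁ ^ k * (2 ^ k * ((t ^ δ') ^ k + (t ^ (-δ')) ^ k)) :=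
            mul_le_mul_of_nonneg_left (Literature.NumberTheory.LFunctions.add_pow_le_two_pow ha hb k) (pow_nonneg hc₁pos.le k)
    -- `(t^{±δ'})^k = t^{±δ}`
    have hkδ : δ' * k = δ := by rw [hδ']; field_simp
    have hp : (t ^ δ') ^ k = t ^ δ := by
      rw [← rpow_natCast, ← rpow_mul ht.le, hkδ]
    have hn : (t ^ (-δ')) ^ k = t ^ (-δ) := by
      rw [← rpow_natCast, ← rpow_mul ht.le, neg_mul, hkδ]
    rw [hp, hn, ← mul_assoc] at h2
    exact h2

/-- `t^{δ−1} ≤ (t^{1+δ})⁻¹ + 1` for `t > 0`, `δ > 0` (`t ≤ 1`: `t^{δ−1} ≤ t^{−1−δ}`; `t ≥ 1`: … ≤ `t^{δ−1} ≤` — for `δ ≤ 1` it is `≤ 1`, and for `δ > 1` we use `t^{δ−1} ≤ t^{δ−1}`… so we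
state the bound only in the form needed: `t^{δ−1} ≤ (t^{1+δ})⁻¹ + t^{δ−1}·𝟙_{t ≥ 1}` is replaced by continuity in §2).  Here: the `t ≤ 1` half. [cite: HarishChandra1970, Part VII §3 p. 73] -/
theorem rpow_sub_one_le_of_le_one {t δ : ℝ} (ht : 0 < t) (ht1 : t ≤ 1) (hδ : 0 < δ) : t ^ (δ - 1) ≤ (t ^ (1 + δ))⁻¹ := by
  rw [← rpow_neg ht.le]
  exact rpow_le_rpow_of_exponent_ge ht ht1 (by linarith)

/-! ## §2 The (D4) passage: `LocallyIntegrable (φ^{1+δ})⁻¹ ⇒ LocallyIntegrable (φ⁻¹ · (1 + |log φ|)^k)` for continuous `φ ≥ 0` -/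

section Measure

variable {X : Type*} [TopologicalSpace X] [MeasurableSpace X] [OpensMeasurableSpace X]

/-- **THE (D4) PASSAGE** [HarishChandra1970, p. 73: «It follows from Theorem 15 that `x ↦ |D(x)|^{−1∕2}(1+|λ(x)|)^{4ℓ}` is locally summable»].  Let `φ : X → ℝ≥0` be CONTINUOUS, `μ`
locally finite, `δ > 0`, `k : ℕ`.  If `x ↦ (φ(x)^{1+δ})⁻¹` is locally integrable (Theorem 15 with `φ = |D|^{1∕2}`, `1 + δ = 1 + 2ε`), then so is the log-weighted inverse
`x ↦ φ(x)⁻¹ · (1 + |log φ(x)|)^k` (at zeros of `φ` both are Lean's `0⁻¹ = 0`; in use the zero set is null).  Proof: on `{0 < φ ≤ 1}`, `φ⁻¹(1+|log φ|)^k ≤ C(φ^{δ−1} + φ^{−1−δ})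
≤ 2C(φ^{1+δ})⁻¹` (§1); on `{φ ≥ 1}` the weight is a continuous function of `φ`, hence locally bounded; so `W ≤ 2C·(φ^{1+δ})⁻¹ + B ∘ φ` with `B` continuous, and
`LocallyIntegrable.mono`. [cite: HarishChandra1970, Part VII §1 Thm 15 p. 63; §3 p. 73] -/
theorem locallyIntegrable_inv_mul_log_pow (μ : Measure X) [IsLocallyFiniteMeasure μ] {φ : X → ℝ≥0} (hφ : Continuous φ)
    {δ : ℝ} (hδ : 0 < δ) (k : ℕ) (hint : LocallyIntegrable (fun x => (((φ x : ℝ)) ^ (1 + δ))⁻¹) μ) :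
    LocallyIntegrable (fun x => ((φ x : ℝ))⁻¹ * (1 + |Real.log (φ x)|) ^ k) μ := by
  obtain ⟨C, hC, hCle⟩ := exists_const_one_add_abs_log_pow_le k hδ
  -- the bounded part: `t ↦ max(t,1)^{δ-1}`-type control is replaced by the continuous `t ↦ (1 + |log (max t 1)|)^k`, which dominates on `{t ≥ 1}`
  -- majorant: `M x := 2C · (φ^{1+δ})⁻¹ + (1 + |log (max (φ x) 1)|)^k`
  have hφc : Continuous fun x : X => (φ x : ℝ) := NNReal.continuous_coe.comp hφ
  have hmaxc : Continuous fun x : X => max (φ x : ℝ) 1 := hφc.max continuous_const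
  have hlogc : Continuous fun x : X => Real.log (max (φ x : ℝ) 1) :=
    hmaxc.log fun x => ne_of_gt (lt_of_lt_of_le zero_lt_one (le_max_right _ _))
  have hcontB : Continuous fun x : X => (1 + |Real.log (max (φ x : ℝ) 1)|) ^ k := (continuous_const.add hlogc.abs).pow k
  have hM : LocallyIntegrable (fun x => 2 * C * (((φ x : ℝ)) ^ (1 + δ))⁻¹ + (1 + |Real.log (max (φ x : ℝ) 1)|) ^ k) μ :=
    (hint.smul (2 * C)).add hcontB.locallyIntegrable
  -- measurability of the weight
  have hmeas : AEStronglyMeasurable (fun x => ((φ x : ℝ))⁻¹ * (1 + |Real.log (φ x)|) ^ k) μ := by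
    have hφm : Measurable fun x => (φ x : ℝ) := (NNReal.continuous_coe.comp hφ).measurable
    exact (hφm.inv.mul ((measurable_const.add (continuous_abs.measurable.comp (Real.measurable_log.comp hφm))).pow_const k)).aestronglyMeasurable
  refine hM.mono hmeas (Eventually.of_forall fun x => ?_)
  -- pointwise bound
  have hφ0 : 0 ≤ (φ x : ℝ) := (φ x).2
  have hRHS0 : 0 ≤ 2 * C * (((φ x : ℝ)) ^ (1 + δ))⁻¹ + (1 + |Real.log (max (φ x : ℝ) 1)|) ^ k := by positivity
  rw [Real.norm_eq_abs, Real.norm_eq_abs, abs_of_nonneg hRHS0, abs_of_nonneg (by positivity)]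
  rcases eq_or_lt_of_le hφ0 with h0 | hpos
  · -- `φ x = 0`: the weight is `0`
    rw [show ((φ x : ℝ))⁻¹ = 0 by rw [← h0, inv_zero], zero_mul]
    exact hRHS0
  · rcases le_or_gt (φ x : ℝ) 1 with hle | hgt
    · -- `0 < φ x ≤ 1`: `φ⁻¹ (1+|log φ|)^k ≤ C φ⁻¹ (φ^δ + φ^{-δ}) = C (φ^{δ-1} + φ^{-1-δ}) ≤ 2C (φ^{1+δ})⁻¹`
      have h1 := hCle _ hpos
      have hinv0 : 0 ≤ ((φ x : ℝ))⁻¹ := inv_nonneg.2 hφ0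
      have hA : ((φ x : ℝ))⁻¹ * (φ x : ℝ) ^ δ = (φ x : ℝ) ^ (δ - 1) := by
        rw [rpow_sub hpos, rpow_one, div_eq_inv_mul]
      have hB : ((φ x : ℝ))⁻¹ * (φ x : ℝ) ^ (-δ) = ((φ x : ℝ) ^ (1 + δ))⁻¹ := by
        rw [rpow_neg hφ0, ← mul_inv, ← rpow_one_add' hφ0 (by linarith)]
      have hAle : (φ x : ℝ) ^ (δ - 1) ≤ ((φ x : ℝ) ^ (1 + δ))⁻¹ := rpow_sub_one_le_of_le_one hpos hle hδ
      calc ((φ x : ℝ))⁻¹ * (1 + |Real.log (φ x)|) ^ k ≤ ((φ x : ℝ))⁻¹ * (C * ((φ x : ℝ) ^ δ + (φ x : ℝ) ^ (-δ))) :=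
            mul_le_mul_of_nonneg_left h1 hinv0
        _ = C * (((φ x : ℝ))⁻¹ * (φ x : ℝ) ^ δ + ((φ x : ℝ))⁻¹ * (φ x : ℝ) ^ (-δ)) := by ring
        _ = C * ((φ x : ℝ) ^ (δ - 1) + ((φ x : ℝ) ^ (1 + δ))⁻¹) := by rw [hA, hB]
        _ ≤ C * (((φ x : ℝ) ^ (1 + δ))⁻¹ + ((φ x : ℝ) ^ (1 + δ))⁻¹) := by
            exact mul_le_mul_of_nonneg_left (by linarith) hC.le
        _ = 2 * C * (((φ x : ℝ)) ^ (1 + δ))⁻¹ := by ring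
        _ ≤ 2 * C * (((φ x : ℝ)) ^ (1 + δ))⁻¹ + (1 + |Real.log (max (φ x : ℝ) 1)|) ^ k := le_add_of_nonneg_right (by positivity)
    · -- `φ x > 1`: `φ⁻¹ ≤ 1` and `log φ = log (max φ 1)`
      have hmax : max (φ x : ℝ) 1 = (φ x : ℝ) := max_eq_left hgt.le
      have hinv1 : ((φ x : ℝ))⁻¹ ≤ 1 := inv_le_one_of_one_le₀ hgt.le
      have hpow0 : 0 ≤ (1 + |Real.log (φ x)|) ^ k := by positivity
      calc ((φ x : ℝ))⁻¹ * (1 + |Real.log (φ x)|) ^ k ≤ 1 * (1 + |Real.log (φ x)|) ^ k :=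
            mul_le_mul_of_nonneg_right hinv1 hpow0
        _ = (1 + |Real.log (max (φ x : ℝ) 1)|) ^ k := by rw [one_mul, hmax]
        _ ≤ 2 * C * (((φ x : ℝ)) ^ (1 + δ))⁻¹ + (1 + |Real.log (max (φ x : ℝ) 1)|) ^ k := le_add_of_nonneg_left (by positivity)

/-- The same with a constant: `LocallyIntegrable (c · φ⁻¹ · (1 + |log φ|)^k)` — the shape of the weight `W = c₅ |D|^{−1∕2}(1+|λ|)^{4ℓ}`.
[cite: HarishChandra1970, Part VII §3 p. 73] -/
theorem locallyIntegrable_const_mul_inv_mul_log_pow (μ : Measure X) [IsLocallyFiniteMeasure μ] {φ : X → ℝ≥0} (hφ : Continuous φ)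
    {δ : ℝ} (hδ : 0 < δ) (k : ℕ) (c : ℝ) (hint : LocallyIntegrable (fun x => (((φ x : ℝ)) ^ (1 + δ))⁻¹) μ) :
    LocallyIntegrable (fun x => c * (((φ x : ℝ))⁻¹ * (1 + |Real.log (φ x)|) ^ k)) μ :=
  (locallyIntegrable_inv_mul_log_pow μ hφ hδ k hint).smul c

end Measure

end Summit.HodgeConjecture.HodgeConjecture.Cruxes.H413.K2E3LogWeightLocallyIntegrable

end
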